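import Summits.Ventures.PercRepro.RankLevelSetHallLoadLemma

/-!
# PercRepro — THE EXTENSION LEMMA (HALL'S CONDITION FOR LOST → BIG) IMPLIES C-044 UP AT THE TIGHT LAYER
(p4, gen 39; paper proofs/P4-TILT-S.md §6, §8, Addenda 3–4; C-044 at the tight layer `#E = p + q`, any `k ≥ 2`)

The complement identity reduces C-044 UP at the tight layer to an injection of the lost sets into the big sets with `T ⊆ μ(T)`
(`hallUp_of_lostBigInj`, RankLevelSetHallComplement).  THIS FILE states the corresponding HALL CONDITION for the inclusion graph
`T ~ B` iff `T ⊆ B` between the lost sets and the big UP-neighbours of the cell — `LostBigHall` (a `Prop`, NOT asserted): every finset `s`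
of lost sets has at least `#s` big sets containing some member of `s` — and proves that it gives the injection (Hall's marriage theorem,
`lostBigInj_of_lostBigHall`) and hence **C-044 UP for every family** (`hallUp_of_lostBigHall`).  `LostBigHall` is THE EXTENSION LEMMA, the
open statement of record after gen 39: it holds with Hall ratio `≥ 1.33` on every instance tested (random `n ≤ 13`, the fat-class and
kernel-A-killer families, the «parallel copy + two spanned points» family), while every local sufficient condition tried (the uniform
LOAD LEMMA, the `λ`-receipt lemma) fails on explicit instances.  Nothing beyond the transfers is asserted.

* `bigSupersets`, `bigSupersets_finite`, `LostBigHall`;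
* **`lostBigInj_of_lostBigHall`**, **`hallUp_of_lostBigHall`**.
Axioms: standard.
-/

namespace PercRepro

open Set Matroid Finset

variable {α : Type} (M : Matroid α) [M.Finite]

/-- The big UP-neighbours of the cell containing `T`. -/
def bigSupersets (p q : ℕ) (T : Set α) : Set (Set α) := {B | B ∈ bigUpSets M p q (cellMembers M p q) ∧ T ⊆ B}

/-- `bigSupersets` is finite. -/
theorem bigSupersets_finite (p q : ℕ) (T : Set α) : (bigSupersets M p q T).Finite :=
  M.ground_finite.finite_subsets.subset (fun _ h => h.1.1.1)

/-- **THE EXTENSION LEMMA** (a `Prop`, NOT asserted): Hall's condition for the inclusion graph between the lost sets and the big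
UP-neighbours of the cell — every finset `s` of lost sets has at least `#s` big sets containing some `T ∈ s`. -/
def LostBigHall (p q : ℕ) : Prop :=
  ∀ s : Finset (Set α), (∀ T ∈ s, T ∈ lostUpSets M p q (cellMembers M p q)) →
    s.card ≤ (s.biUnion (fun T => (bigSupersets_finite M p q T).toFinset)).card

/-- **The injection from the extension lemma** (Hall's marriage theorem). -/
theorem lostBigInj_of_lostBigHall (p q : ℕ) (h : LostBigHall M p q) : LostBigInj M p q := by
  classical
  set L : Finset (Set α) := (lostUpSets_finite M p q (cellMembers M p q)).toFinset with hLdef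
  have hmemL : ∀ T, T ∈ L ↔ T ∈ lostUpSets M p q (cellMembers M p q) := fun T => by
    rw [hLdef, Set.Finite.mem_toFinset]
  let t : {T // T ∈ L} → Finset (Set α) := fun T => (bigSupersets_finite M p q T.1).toFinset
  have hhall : ∀ s : Finset {T // T ∈ L}, s.card ≤ (s.biUnion t).card := by
    intro s
    have h1 : s.card = (s.image Subtype.val).card :=
      (Finset.card_image_of_injective s Subtype.val_injective).symm
    have h2 : (s.image Subtype.val).biUnion (fun T => (bigSupersets_finite M p q T).toFinset) = s.biUnion t :=
      Finset.image_biUnion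
    rw [h1, ← h2]
    apply h
    intro T hT
    obtain ⟨T', -, rfl⟩ := Finset.mem_image.mp hT
    exact (hmemL T'.1).mp T'.2
  obtain ⟨f, hfinj, hft⟩ := (Finset.all_card_le_biUnion_card_iff_exists_injective t).mp hhall
  refine ⟨fun T => if h : T ∈ L then f ⟨T, h⟩ else T, ?_, ?_⟩
  · intro T hT
    have hTL : T ∈ L := (hmemL T).mpr hT
    simp only [hTL, dite_true]
    have hmem : f ⟨T, hTL⟩ ∈ bigSupersets M p q T := by
      have := hft ⟨T, hTL⟩
      rwa [Set.Finite.mem_toFinset] at this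
    exact ⟨hmem.1, hmem.2⟩
  · intro T₁ hT₁ T₂ hT₂ heq
    have h₁ : T₁ ∈ L := (hmemL T₁).mpr hT₁
    have h₂ : T₂ ∈ L := (hmemL T₂).mpr hT₂
    simp only [h₁, h₂, dite_true] at heq
    exact congrArg Subtype.val (hfinj heq)

/-- **C-044 UP AT THE TIGHT LAYER FROM THE EXTENSION LEMMA**: the UP-Hall condition for every family of members. -/
theorem hallUp_of_lostBigHall (p q : ℕ) (hE : M.E.ncard = p + q) (h : LostBigHall M p q) (𝒜 : Set (Set α))
    (h𝒜 : 𝒜 ⊆ cellMembers M p q) :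
    phiK p q * (𝒜.ncard : ℚ) ≤ ((upNbhd M p q 𝒜).ncard : ℚ) :=
  hallUp_of_lostBigInj M p q hE (lostBigInj_of_lostBigHall M p q h) 𝒜 h𝒜

end PercRepro
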